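import Literature.Computability.Cryptography.RegevSamplerZoneStd
import Literature.Computability.Cryptography.RegevSamplerStageCircuit
import Literature.Computability.QuantumComplexity.StageAbstract
import HarnessLib

/-!
# The oracle stage of the sampler machine: placement formula and abstract shape (Regev 2009, Lemma 3.14: uniformity, stage S2)

Topic `Literature/Computability/Cryptography`; gen-11 module M3/S2 (placement part) of the sampler route for
`regev2009_lemma_3_14_stepFamily`. The oracle stage of the machine circuit is
`stageCirc hΛ hF (subE hΛ Z) T` with `T = tidyCirc (Rf.family.circ Λ.kq)` the tidied oracle-solver: the branch
block, the residue block, `T` transported by the placement `subE hΛ Z`, the erasing block, `T` again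
(`RegevSamplerStageCircuit.lean`). For the uniformity proof (abstract gate lists on codes, `StageAbstract.lean`,
`AbstractGateUniform.lean`) this file provides

* `subA` — the placement as an explicit `ℕ`-formula of the layout offsets: query wires to the input prefix / the
  residue zone, answer wires to the answer zone, subroutine wires to the work window;
  **`val_subE_stdZone`** — `(subE hΛ (stdZone Λ hΛ hroom) w : ℕ) = subA Λ.Lq Λ.oU Λ.oS Λ.kq (n·Λ.bc) Λ.oA Λ.base w`
  (layouts with `loc = id`);
* **`map_toAG_stageCirc`** — the abstract gate list of the oracle stage is the five-segment concatenation
  `Y ++ S ++ T̂ ++ X ++ T̂` with `T̂ = (T.gates.map toAG).map (AGmap f)` for any `f` agreeing with the placement;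
* **`subA_codeFP`** — `subA` on codes (seven numerals and the wire).

No named fact is introduced.

HONEST FRAMING: the VALUE is a THEOREM (kernel-checked lemmas of a KNOWN reduction, Regev 2009) — NOT summit
progress; the trust base `{A_q14}` of `pqc.S19` is unchanged by this file.

## References

* O. Regev, *On lattices, learning with errors, random linear codes, and cryptography*, J. ACM 56(6) (2009),
  Lemma 3.14 (proof: the oracle call on the query register; uniformity) [Regev2009].
* C. H. Bennett, E. Bernstein, G. Brassard, U. Vazirani, *Strengths and weaknesses of quantum computing*,
  SIAM J. Comput. 26 (1997), Thm. 4.14 (tidy subroutines) [BennettBernsteinBrassardVazirani1997].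
* S. Arora, B. Barak, *Computational Complexity: A Modern Approach*, CUP 2009, §6.2 and proof of Thm. 6.15
  [AroraBarak2009].
-/

noncomputable section

namespace Literature.Computability.Cryptography.Regev2009.SamplerSubst

open _root_.Computability Literature.Computability.QuantumComplexity Literature.Computability.QuantumComplexity.AJLCore
  Literature.Computability.Complexity Literature.Computability.Complexity.CodeFP SamplerClassical SamplerClassical.Layout

/-! ### The placement formula -/

/-- **The placement of the tidy block as a formula**: wire `w < k_q` is query bit `w` (in the input prefix if
`w < L_q`, else in the residue zone), `k_q ≤ w < k_q + n·b_c` is an answer wire, the rest is the subroutine's work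
register above the base. [cite: Regev2009, Lemma 3.14 (proof)] [cite: BennettBernsteinBrassardVazirani1997, Thm. 4.14] -/
def subA (Lq oU oS kq nbc oA base w : ℕ) : ℕ :=
  if w < kq then (if w < Lq then oU + w else oS + (w - Lq))
  else if w < kq + nbc then oA + (w - kq) else base + (w - (kq + nbc))

variable {W n : ℕ} {Λ : SamplerClassical.Layout W n} (hΛ : Λ.OK)

/-- **The standard placement is `subA`** (layouts with `loc = id`). [cite: Regev2009, Lemma 3.14 (proof)] -/
theorem val_subE_stdZone {d : ℕ} (hroom : Λ.base + (Λ.kq + d) ≤ W) (hloc : ∀ s, Λ.loc s = s)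
    (w : Fin (TidyBlockFn.W Λ.kq (n * Λ.bc) d)) :
    (subE hΛ (stdZone Λ hΛ hroom) w : ℕ) = subA Λ.Lq Λ.oU Λ.oS Λ.kq (n * Λ.bc) Λ.oA Λ.base w := by
  obtain ⟨h1, h2, h3, h4, h5, h6⟩ := offsets_eq Λ
  have hLq := hΛ.Lq_le
  have hw := w.isLt
  simp only [TidyBlockFn.W] at hw
  unfold subA
  by_cases hq : (w : ℕ) < Λ.kq
  · have ew : w = TidyBlockFn.qW (ℓ := n * Λ.bc) (d := d) ⟨w, hq⟩ := Fin.ext (by rw [TidyBlockFn.val_qW])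
    rw [if_pos hq]
    conv_lhs => rw [ew, subE_qW hΛ]
    rw [qryWire, fin_val hΛ (qryIdx_lt_T hΛ _), hloc, qryIdx]
  · rw [if_neg hq]
    by_cases ha : (w : ℕ) < Λ.kq + n * Λ.bc
    · have ew : w = TidyBlockFn.aW (k := Λ.kq) (d := d) ⟨(w : ℕ) - Λ.kq, by omega⟩ :=
        Fin.ext (by rw [TidyBlockFn.val_aW]; simp only; omega)
      rw [if_pos ha]
      conv_lhs => rw [ew, subE_aW hΛ]
      rw [fin_val hΛ (by simp only; omega), hloc]
    · have ew : w = TidyBlockFn.dE Λ.kq (n * Λ.bc) d ⟨(w : ℕ) - (Λ.kq + n * Λ.bc), by omega⟩ :=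
        Fin.ext (by rw [TidyBlockFn.val_dE]; simp only; omega)
      rw [if_neg ha]
      conv_lhs => rw [ew, subE_dE hΛ]
      rfl

/-! ### The abstract shape of the oracle stage -/

/-- **The oracle stage abstracts to five segments**: branch block, residue block, the transported subroutine,
erasing block, the transported subroutine. [cite: Regev2009, Lemma 3.14 (proof)] [cite: AroraBarak2009, §6.2] -/
theorem map_toAG_stageCirc (hF : Fits Λ) {M : ℕ} (E : Fin M ↪ Fin W) (T : QCircuit cliffordT M) (f : ℕ → ℕ)
    (hf : ∀ x : Fin M, f x = (E x : ℕ)) :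
    (stageCirc hΛ hF E T).gates.map toAG =
      (circY hΛ hF).gates.map toAG ++ (circS hΛ hF).gates.map toAG ++ (T.gates.map toAG).map (AGmap f) ++
        (circX hΛ hF).gates.map toAG ++ (T.gates.map toAG).map (AGmap f) := by
  simp only [stageCirc, QCircuit.gates_append, List.map_append, map_toAG_mapWires E f hf]

/-- The same for the standard placement: the wire map is `subA`. [cite: Regev2009, Lemma 3.14 (proof)] -/
theorem map_toAG_stageCirc_std (hF : Fits Λ) {d : ℕ} (hroom : Λ.base + (Λ.kq + d) ≤ W) (hloc : ∀ s, Λ.loc s = s)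
    (T : QCircuit cliffordT (TidyBlockFn.W Λ.kq (n * Λ.bc) d)) :
    (stageCirc hΛ hF (subE hΛ (stdZone Λ hΛ hroom)) T).gates.map toAG =
      (circY hΛ hF).gates.map toAG ++ (circS hΛ hF).gates.map toAG ++
        (T.gates.map toAG).map (AGmap (subA Λ.Lq Λ.oU Λ.oS Λ.kq (n * Λ.bc) Λ.oA Λ.base)) ++
        (circX hΛ hF).gates.map toAG ++ (T.gates.map toAG).map (AGmap (subA Λ.Lq Λ.oU Λ.oS Λ.kq (n * Λ.bc) Λ.oA Λ.base)) :=
  map_toAG_stageCirc hΛ hF _ T _ fun w => (val_subE_stdZone hΛ hroom hloc w).symm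

/-! ### The placement formula on codes -/

/-- The code of the placement parameters `(Lq, oU, oS, kq, nbc, oA, base)`: seven numerals. [folklore] -/
abbrev e7E : ℕ × ℕ × ℕ × ℕ × ℕ × ℕ × ℕ → List Bool :=
  pairE natE (pairE natE (pairE natE (pairE natE (pairE natE (pairE natE natE)))))

/-- **`subA` on codes**: input `(params, w)`. [cite: AroraBarak2009, §6.2 and proof of Thm. 6.15] -/
theorem subA_codeFP : CodeFP (pairE e7E natE) natE
    (fun q => subA q.1.1 q.1.2.1 q.1.2.2.1 q.1.2.2.2.1 q.1.2.2.2.2.1 q.1.2.2.2.2.2.1 q.1.2.2.2.2.2.2 q.2) := by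
  have hP : CodeFP (pairE e7E natE) e7E (fun q => q.1) := fst _ _
  have hw : CodeFP (pairE e7E natE) natE (fun q => q.2) := snd _ _
  have hLq : CodeFP (pairE e7E natE) natE (fun q => q.1.1) := hP.fst'
  have hoU : CodeFP (pairE e7E natE) natE (fun q => q.1.2.1) := hP.snd'.fst'
  have hoS : CodeFP (pairE e7E natE) natE (fun q => q.1.2.2.1) := hP.snd'.snd'.fst'
  have hkq : CodeFP (pairE e7E natE) natE (fun q => q.1.2.2.2.1) := hP.snd'.snd'.snd'.fst'
  have hnbc : CodeFP (pairE e7E natE) natE (fun q => q.1.2.2.2.2.1) := hP.snd'.snd'.snd'.snd'.fst'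
  have hoA : CodeFP (pairE e7E natE) natE (fun q => q.1.2.2.2.2.2.1) := hP.snd'.snd'.snd'.snd'.snd'.fst'
  have hbase : CodeFP (pairE e7E natE) natE (fun q => q.1.2.2.2.2.2.2) := hP.snd'.snd'.snd'.snd'.snd'.snd'
  have c1 : CodeFP (pairE e7E natE) bitE (fun q => decide (q.2 < q.1.2.2.2.1)) := (natLt.comp (hw.pair hkq) :)
  have c2 : CodeFP (pairE e7E natE) bitE (fun q => decide (q.2 < q.1.1)) := (natLt.comp (hw.pair hLq) :)
  have c3 : CodeFP (pairE e7E natE) bitE (fun q => decide (q.2 < q.1.2.2.2.1 + q.1.2.2.2.2.1)) :=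
    (natLt.comp (hw.pair (natAdd.comp (hkq.pair hnbc))) :)
  have b1 : CodeFP (pairE e7E natE) natE (fun q => q.1.2.1 + q.2) := (natAdd.comp (hoU.pair hw) :)
  have b2 : CodeFP (pairE e7E natE) natE (fun q => q.1.2.2.1 + (q.2 - q.1.1)) :=
    (natAdd.comp (hoS.pair (natSub.comp (hw.pair hLq))) :)
  have b3 : CodeFP (pairE e7E natE) natE (fun q => q.1.2.2.2.2.2.1 + (q.2 - q.1.2.2.2.1)) :=
    (natAdd.comp (hoA.pair (natSub.comp (hw.pair hkq))) :)
  have b4 : CodeFP (pairE e7E natE) natE (fun q => q.1.2.2.2.2.2.2 + (q.2 - (q.1.2.2.2.1 + q.1.2.2.2.2.1))) :=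
    (natAdd.comp (hbase.pair (natSub.comp (hw.pair (natAdd.comp (hkq.pair hnbc))))) :)
  exact (iteProp c1 (iteProp c2 b1 b2) (iteProp c3 b3 b4)).congr fun _ => rfl

/-- **`subA` with the parameters read off a context on codes** (the `f` of `mapAGmap_codeFP`). [cite: AroraBarak2009, §6.2] -/
theorem subA_codeFP_of {σ : Type} {eσ : σ → List Bool} {Lq oU oS kq nbc oA base : σ → ℕ} (hLq : CodeFP eσ natE Lq)
    (hoU : CodeFP eσ natE oU) (hoS : CodeFP eσ natE oS) (hkq : CodeFP eσ natE kq) (hnbc : CodeFP eσ natE nbc)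
    (hoA : CodeFP eσ natE oA) (hbase : CodeFP eσ natE base) :
    CodeFP (pairE eσ natE) natE (fun q => subA (Lq q.1) (oU q.1) (oS q.1) (kq q.1) (nbc q.1) (oA q.1) (base q.1) q.2) := by
  have hp : CodeFP eσ e7E (fun c => (Lq c, oU c, oS c, kq c, nbc c, oA c, base c)) :=
    hLq.pair (hoU.pair (hoS.pair (hkq.pair (hnbc.pair (hoA.pair hbase)))))
  exact (subA_codeFP.comp ((hp.comp (fst _ _)).pair (snd _ _)) :)

end Literature.Computability.Cryptography.Regev2009.SamplerSubst

end
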